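import Literature.AlgebraicGeometry.Motives.HodgeLieRealPlacesSl2
import Literature.AlgebraicGeometry.Motives.HodgeLieRankLowerBound
import Literature.AlgebraicGeometry.Motives.MumfordTateLieAlgebraEqHodgeLie
import HarnessLib

/-!
# The rank of the Hodge group in the real-places situation: `dim Lie Hdg(H) = 3 · #{places}` (Hazama 1983 §3, Ribet 1983: `Hg = R_{E/ℚ} SL₂`)

Pure `ℚ`-Hodge structures `H` of ODD weight `n` on a finite-dimensional `V` with a polarization `ψ` for which every Hodge
endomorphism is `ψ`-self-adjoint, and REAL characters `σ_i : End_Hdg(V) → ℂ` (`i ∈ ι`) whose eigenblocks `T_{σ_i}` are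
two-dimensional and form an internal direct sum `V_ℂ = ⊕_i T_{σ_i}` — the hypotheses of the tree's
`HodgeStructure.mem_hodgeLieC_iff_mapsTo_and_skew` (`Motives/HodgeLieRealPlacesSl2`: `Lie Hdg(H) ⊗ ℂ = ⊕_i 𝔰𝔩(T_{σ_i})`).

* `finrank_traceFree_blocks` — the families `(N_i)_{i ∈ ι}` of trace-free complex `2 × 2` matrices form a space of dimension
  `3 · #ι` (kernel of the surjective slotwise trace `(ι → M₂(ℂ)) → (ι → ℂ)`).
* **`finrank_hodgeLieC_eq_of_real_blocks`**, **`finrank_hodgeLie_eq_of_real_blocks`** — `dim_ℂ Lie Hdg(H) ⊗ ℂ =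
  dim_ℚ Lie Hdg(H) = 3 · #ι`: the block extractor `RealPlaces.blockMat` restricts to a linear bijection from `Lie Hdg(H) ⊗ ℂ`
  onto the trace-free families (injective on block-preserving operators, `RealPlaces.eq_of_blockMat_eq`; trace-free values,
  `trace_blockMat_eq_zero`; onto, `assemble_mem_hodgeLieC_of_forall_trace_eq_zero`) — Hazama's count «`𝔥 = 𝔰𝔩₂ × ⋯ × 𝔰𝔩₂`
  (`k` times)», i.e. `dim Hg = 3[E:ℚ]` for `Hg = R_{E/ℚ} SL_{2,E}` (Ribet).
* **`mtRank_eq_of_real_blocks`** — `dim MT(H) = 3 · #ι + 1` (`n ≠ 0`; the tree's `mtRank_eq_finrank_hodgeLie_add_one`).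

UNCONDITIONAL; no definition, no named fact; research context: cell `pub-hodgecm2` (COR-CM, seat b27 gen 40), input of the
rung `dim MT(H¹X) = 3 dim X + 1` for real multiplication of relative dimension one (`HodgeTheory/RealMultiplicationMumfordTateRank`).

## References
* [Hazama1983] F. Hazama, *Hodge cycles on abelian varieties of CM type*, Tôhoku Math. J. 35 (1983), Thm. (1.1) and §3
  (pp. 305–306). [cite: Hazama1983, Thm. (1.1) and §3 (pp. 305–306)]
* [Ribet1983] K. A. Ribet, *Hodge classes on certain types of abelian varieties*, Amer. J. Math. 105 (1983), Thm. 0–1.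
  [cite: Ribet1983, Thm. 0–1]
-/

noncomputable section

open scoped TensorProduct
open Module

namespace Literature.AlgebraicGeometry.Motives

namespace HodgeStructure

open RealPlaces

universe u

variable {V : Type u} [AddCommGroup V] [Module ℚ V] [Module.Finite ℚ V] [HodgeTensorFacts.{u, u}] {n : ℤ}
variable {ι : Type*} [Fintype ι] [DecidableEq ι]

omit [HodgeTensorFacts.{u, u}] [DecidableEq ι] in
/-- **The trace-free families of `2 × 2` matrices have dimension `3 · #ι`**: the slotwise trace
`(ι → M₂(K)) → (ι → K)` is surjective with this kernel. [cite: Hazama1983, §3 (p. 306)] -/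
theorem finrank_traceFree_blocks (K : Type*) [Field K] (ι : Type*) [Fintype ι] :
    Module.finrank K (LinearMap.ker (LinearMap.pi fun k : ι =>
      (Matrix.traceLinearMap (Fin 2) K K).comp (LinearMap.proj k) :
        (ι → Matrix (Fin 2) (Fin 2) K) →ₗ[K] (ι → K))) = 3 * Fintype.card ι := by
  classical
  set tr : (ι → Matrix (Fin 2) (Fin 2) K) →ₗ[K] (ι → K) :=
    LinearMap.pi fun k : ι => (Matrix.traceLinearMap (Fin 2) K K).comp (LinearMap.proj k) with htr
  have htr_apply : ∀ N k, tr N k = (N k).trace := fun N k => rfl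
  -- surjective: `N k = diag(c k, 0)`
  have hsurj : LinearMap.range tr = ⊤ := by
    rw [LinearMap.range_eq_top]
    intro c
    refine ⟨fun k => Matrix.of ![![c k, 0], ![0, 0]], funext fun k => ?_⟩
    rw [htr_apply, Matrix.trace_fin_two]
    simp
  have hrn := LinearMap.finrank_range_add_finrank_ker tr
  rw [hsurj, finrank_top, Module.finrank_fintype_fun_eq_card, Module.finrank_pi_fintype] at hrn
  simp only [Module.finrank_matrix, Module.finrank_self, Fintype.card_fin, Finset.sum_const, Finset.card_univ,
    smul_eq_mul, mul_one] at hrn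
  omega

/-- **`dim_ℂ (Lie Hdg(H) ⊗ ℂ) = 3 · #ι` in the real-places situation** (`Lie Hdg(H) ⊗ ℂ = ⊕_i 𝔰𝔩(T_{σ_i})`, Hazama 1983 §3
«`𝔥 = 𝔰𝔩₂ × ⋯ × 𝔰𝔩₂` (`k` times)»; Ribet 1983 `Hg = R_{E/ℚ} SL₂`): in real block bases the block extractor is a linear
bijection from `Lie Hdg(H) ⊗ ℂ` onto the trace-free families. [cite: Hazama1983, Thm. (1.1) and §3 (pp. 305–306)]
[cite: Ribet1983, Thm. 0–1] -/
theorem finrank_hodgeLieC_eq_of_real_blocks (H : HodgeStructure V n) (hn : Odd n) (ψ : H.Polarization)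
    (hself : ∀ a : H.endAlg,
      LinearMap.IsAdjointPair ψ.form ψ.form (a : Module.End ℚ V) (a : Module.End ℚ V))
    (σ : ι → (H.endAlg →+* ℂ)) (hreal : ∀ i, (starRingEnd ℂ).comp (σ i) = σ i)
    (hint : DirectSum.IsInternal fun i => H.eigenBlock (σ i))
    (h2 : ∀ i, Module.finrank ℂ (H.eigenBlock (σ i)) = 2) :
    Module.finrank ℂ H.hodgeLieC = 3 * Fintype.card ι := by
  classical
  obtain ⟨b, hb⟩ := exists_real_blockBasis H σ hreal h2
  set tr : (ι → Matrix (Fin 2) (Fin 2) ℂ) →ₗ[ℂ] (ι → ℂ) :=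
    LinearMap.pi fun k : ι => (Matrix.traceLinearMap (Fin 2) ℂ ℂ).comp (LinearMap.proj k) with htr
  have htr_apply : ∀ N k, tr N k = (N k).trace := fun N k => rfl
  have hmaps : ∀ Y ∈ H.hodgeLieC, ∀ i, Set.MapsTo Y (H.eigenBlock (σ i)) (H.eigenBlock (σ i)) :=
    fun Y hY i => mapsTo_of_mem_hodgeLieC H σ hY i
  have hskew : ∀ Y ∈ H.hodgeLieC, ∀ x y, ψ.form.baseChange ℂ (Y x) y + ψ.form.baseChange ℂ x (Y y) = 0 :=
    fun Y hY x y => by rw [formBaseChange_skew_of_mem_hodgeLieC ψ hY x y, neg_add_cancel]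
  -- the block extractor, restricted and corestricted
  have hval : ∀ Y : H.hodgeLieC, blockMat hint b (Y : Module.End ℂ (ℂ ⊗[ℚ] V)) ∈ LinearMap.ker tr := fun Y => by
    rw [LinearMap.mem_ker]
    funext k
    rw [htr_apply, Pi.zero_apply]
    exact trace_blockMat_eq_zero H hn ψ hself σ hint b (hmaps Y Y.2) (hskew Y Y.2) k
  set g : H.hodgeLieC →ₗ[ℂ] LinearMap.ker tr :=
    LinearMap.codRestrict (LinearMap.ker tr) ((blockMat hint b).comp H.hodgeLieC.subtype) (fun Y => hval Y) with hg
  have hg_apply : ∀ Y : H.hodgeLieC, (g Y : ι → Matrix (Fin 2) (Fin 2) ℂ) = blockMat hint b (Y : Module.End ℂ _) :=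
    fun Y => rfl
  have hinj : Function.Injective g := by
    intro Y Y' h
    apply Subtype.ext
    have h' := congrArg Subtype.val h
    rw [hg_apply, hg_apply] at h'
    exact eq_of_blockMat_eq hint b (hmaps Y Y.2) (hmaps Y' Y'.2) h'
  have hsurj : Function.Surjective g := by
    intro N
    have hN : ∀ k, ((N : ι → Matrix (Fin 2) (Fin 2) ℂ) k).trace = 0 := fun k => by
      have h := N.2
      rw [LinearMap.mem_ker] at h
      have h' := congr_fun h k
      rwa [htr_apply, Pi.zero_apply] at h'
    refine ⟨⟨assemble hint b N, assemble_mem_hodgeLieC_of_forall_trace_eq_zero H hn ψ hself σ hint b hb N hN⟩,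
      Subtype.ext ?_⟩
    rw [hg_apply]
    exact blockMat_assemble hint b N
  rw [(LinearEquiv.ofBijective g ⟨hinj, hsurj⟩).finrank_eq]
  exact finrank_traceFree_blocks ℂ ι

/-- **`dim_ℚ Lie Hdg(H) = 3 · #ι`** in the real-places situation (`Hg = R_{E/ℚ} SL_{2,E}` has dimension `3[E:ℚ]`).
[cite: Hazama1983, Thm. (1.1) and §3 (pp. 305–306)] [cite: Ribet1983, Thm. 0–1] -/
theorem finrank_hodgeLie_eq_of_real_blocks (H : HodgeStructure V n) (hn : Odd n) (ψ : H.Polarization)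
    (hself : ∀ a : H.endAlg,
      LinearMap.IsAdjointPair ψ.form ψ.form (a : Module.End ℚ V) (a : Module.End ℚ V))
    (σ : ι → (H.endAlg →+* ℂ)) (hreal : ∀ i, (starRingEnd ℂ).comp (σ i) = σ i)
    (hint : DirectSum.IsInternal fun i => H.eigenBlock (σ i))
    (h2 : ∀ i, Module.finrank ℂ (H.eigenBlock (σ i)) = 2) :
    Module.finrank ℚ H.hodgeLie = 3 * Fintype.card ι := by
  rw [← finrank_hodgeLieC H]
  exact finrank_hodgeLieC_eq_of_real_blocks H hn ψ hself σ hreal hint h2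

/-- **`dim MT(H) = 3 · #ι + 1`** in the real-places situation (`MT = 𝔾_m · R_{E/ℚ} SL_{2,E}`; the tree's
`mtRank_eq_finrank_hodgeLie_add_one`). [cite: Hazama1983, Thm. (1.1) and §3 (pp. 305–306)] [cite: Ribet1983, Thm. 0–1] -/
theorem mtRank_eq_of_real_blocks [Nontrivial V] (H : HodgeStructure V n) (hn : Odd n) (ψ : H.Polarization)
    (hself : ∀ a : H.endAlg,
      LinearMap.IsAdjointPair ψ.form ψ.form (a : Module.End ℚ V) (a : Module.End ℚ V))
    (σ : ι → (H.endAlg →+* ℂ)) (hreal : ∀ i, (starRingEnd ℂ).comp (σ i) = σ i)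
    (hint : DirectSum.IsInternal fun i => H.eigenBlock (σ i))
    (h2 : ∀ i, Module.finrank ℂ (H.eigenBlock (σ i)) = 2) :
    H.mtRank = 3 * Fintype.card ι + 1 := by
  have hn0 : n ≠ 0 := by rintro rfl; exact (Int.not_odd_iff_even.2 (by decide)) hn
  rw [mtRank_eq_finrank_hodgeLie_add_one H ψ hn0, finrank_hodgeLie_eq_of_real_blocks H hn ψ hself σ hreal hint h2]

end HodgeStructure

end Literature.AlgebraicGeometry.Motives

end
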